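import Mathlib
import HarnessLib

/-!
# Crux `DigitPolyUniformity` (stmt-QuantumAdvantage-1392), line `Sketch`, cycle 7 — Stub KMT-regroup

Regrouping a two-ends correlation into block/residue sums: for any `lam : ℕ → ℝ`, any `1`-bounded
`g : ℕ → ℕ → ℝ` and `h ≤ n`, the range `[0, 2^n)` is the disjoint union of the `2^(n-h)` aligned blocks
`[2^h y, 2^h y + 2^h)`; on block `y` one has `⌊N / 2^h⌋ = y`, and grouping the block by the residue
`a = N mod 2^k` the factor `g a y` comes out of the inner sum, whence
`|Σ_{N<2ⁿ} lam(N) g(N mod 2^k, ⌊N/2^h⌋)| ≤ Σ_{y<2^{n-h}} Σ_{a<2^k} |Σ_{N ∈ block y, N ≡ a (2^k)} lam(N)|`.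
-/

noncomputable section

namespace Summit.QuantumAdvantage.DigitPolyUniformity.SketchLAR.KMT

open Finset

/-- Splitting a sum over `range (B * M)` into the `M` consecutive blocks `Ico (B * y) (B * y + B)`.
[folklore] -/
private lemma sum_range_mul_eq_sum_blocks (F : ℕ → ℝ) (B M : ℕ) :
    ∑ N ∈ range (B * M), F N = ∑ y ∈ range M, ∑ N ∈ Ico (B * y) (B * y + B), F N := by
  induction M with
  | zero => simp
  | succ M ih =>
    rw [Finset.sum_range_succ, ← ih, Nat.mul_succ, Finset.range_eq_Ico, Finset.range_eq_Ico]
    exact (Finset.sum_Ico_consecutive _ (Nat.zero_le _) (Nat.le_add_right _ _)).symm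

/-- On the aligned block `Ico (B * y) (B * y + B)` the quotient by `B` is constant equal to `y`.
[folklore] -/
private lemma div_eq_of_mem_block {B y N : ℕ} (hN : N ∈ Ico (B * y) (B * y + B)) : N / B = y := by
  rw [Finset.mem_Ico] at hN
  obtain ⟨h1, h2⟩ := hN
  have hB : 0 < B := by
    rcases Nat.eq_zero_or_pos B with hB | hB
    · subst hB; simp at h2
    · exact hB
  obtain ⟨r, rfl⟩ := Nat.exists_eq_add_of_le h1
  have hr : r < B := by omega
  rw [Nat.mul_add_div hB, Nat.div_eq_of_lt hr, add_zero]

/-- **Stub KMT-regroup (regrouping a two-ends correlation into block/residue sums).** For any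
`lam : ℕ → ℝ`, `g` `1`-bounded and `h ≤ n`:
`|Σ_{N<2ⁿ} lam(N) g(N mod 2^k, ⌊N/2^h⌋)| ≤ Σ_{y<2^{n-h}} Σ_{a<2^k} |Σ_{N ∈ [2^h y, 2^h y + 2^h), N ≡ a (2^k)} lam(N)|`.
[folklore] -/
theorem stub_kmt_regroup (lam : ℕ → ℝ) (g : ℕ → ℕ → ℝ) (hg : ∀ a b, |g a b| ≤ 1) (n k h : ℕ) (hhn : h ≤ n) :
    |∑ N ∈ range (2 ^ n), lam N * g (N % 2 ^ k) (N / 2 ^ h)| ≤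
      ∑ y ∈ range (2 ^ (n - h)), ∑ a ∈ range (2 ^ k),
        |∑ N ∈ (Ico (2 ^ h * y) (2 ^ h * y + 2 ^ h)).filter (fun N => N % 2 ^ k = a), lam N| := by
  have h2n : 2 ^ n = 2 ^ h * 2 ^ (n - h) := by rw [← pow_add, Nat.add_sub_cancel' hhn]
  -- on each block, regroup by residue and pull `g a y` out
  have hinner : ∀ y ∈ range (2 ^ (n - h)),
      ∑ N ∈ Ico (2 ^ h * y) (2 ^ h * y + 2 ^ h), lam N * g (N % 2 ^ k) (N / 2 ^ h) =
      ∑ a ∈ range (2 ^ k),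
        g a y * ∑ N ∈ (Ico (2 ^ h * y) (2 ^ h * y + 2 ^ h)).filter (fun N => N % 2 ^ k = a), lam N := by
    intro y _
    have hpt : ∀ N ∈ Ico (2 ^ h * y) (2 ^ h * y + 2 ^ h),
        lam N * g (N % 2 ^ k) (N / 2 ^ h) = lam N * g (N % 2 ^ k) y := by
      intro N hN
      rw [div_eq_of_mem_block hN]
    rw [Finset.sum_congr rfl hpt]
    have hfib := Finset.sum_fiberwise_of_maps_to (s := Ico (2 ^ h * y) (2 ^ h * y + 2 ^ h))
      (t := range (2 ^ k)) (g := fun N => N % 2 ^ k)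
      (fun N _ => Finset.mem_range.2 (Nat.mod_lt N (Nat.two_pow_pos k)))
      (fun N => lam N * g (N % 2 ^ k) y)
    rw [← hfib]
    refine Finset.sum_congr rfl (fun a _ => ?_)
    rw [Finset.mul_sum]
    refine Finset.sum_congr rfl (fun N hN => ?_)
    rw [(Finset.mem_filter.1 hN).2, mul_comm]
  rw [h2n, sum_range_mul_eq_sum_blocks _ (2 ^ h) (2 ^ (n - h)), Finset.sum_congr rfl hinner]
  -- bound by absolute values and use `|g a y| ≤ 1`
  refine (Finset.abs_sum_le_sum_abs _ _).trans (Finset.sum_le_sum (fun y _ => ?_))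
  refine (Finset.abs_sum_le_sum_abs _ _).trans (Finset.sum_le_sum (fun a _ => ?_))
  rw [abs_mul]
  calc |g a y| * |∑ N ∈ (Ico (2 ^ h * y) (2 ^ h * y + 2 ^ h)).filter (fun N => N % 2 ^ k = a), lam N|
      ≤ 1 * |∑ N ∈ (Ico (2 ^ h * y) (2 ^ h * y + 2 ^ h)).filter (fun N => N % 2 ^ k = a), lam N| :=
        mul_le_mul_of_nonneg_right (hg _ _) (abs_nonneg _)
    _ = _ := one_mul _

end Summit.QuantumAdvantage.DigitPolyUniformity.SketchLAR.KMT

end
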